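import Summits.ValiantsHypothesis.ValiantsHypothesis.Theses.DivisionGap
import Summits.ValiantsHypothesis.ValiantsHypothesis.Theorems.PerDivisionHard.Negative.BooleanShadow

/-!
# `DivisionGap.PerMultiplesHard` (stmt-ValiantsHypothesis-5068): monomial multipliers containing a
perfect matching trivialise the Boolean shadow — negative knowledge from the standing disprover

The Boolean transfer (a monotone arithmetic circuit for `g` yields a monotone Boolean circuit of the
same size for the "shadow" `S ↦ ∃ m ∈ supp g, supp m ⊆ S`) is the only technique in print giving
super-polynomial lower bounds for multiples `per_n · h` beyond monomial `h` (Razborov 1985 via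
`shadow_perPoly_mul_iff`, sibling file `PerDivisionHard/Negative/BooleanShadow.lean`, when
`coeff 0 h ≠ 0`).  For the crux `PerMultiplesHard` the multiplier `h` is not charged, and this file
records in closed form how cheaply the shadow is neutralised:

* `mem_support_perPoly_mul_monomial` — `supp(per_n · a x^d) = {μ_ρ + d}`.
* `shadow_perPoly_mul_monomial_iff` — if `supp d` contains the pattern of SOME permutation, the
  shadow of `per_n · a x^d` is `S ⊇ supp d`, an AND of variables (generalises the sibling's void
  shadow at `d = 𝟙`, `shadow_perPoly_mul_prod_X_iff`).
* `shadow_perPoly_mul_diagonal_iff` — the diagonal instance `d = μ_{id}`: "`S` contains the diagonal".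

So the Boolean transfer proves no instance of `PerMultiplesHard` that it does not already prove for
`h = 1`, and it proves none with exponent `c ≥ 2`.
-/

noncomputable section

namespace Summit.ValiantsHypothesis.Theorems.PerMultiplesHardNegative

open Literature.Computability.AlgebraicComplexity MvPolynomial
open Summit.ValiantsHypothesis.Theorems.PerDivisionHardNegative
open scoped NNReal

variable {n : ℕ}

/-- Support of `per_n · (a x^d)`: exactly the exponents `μ_ρ + d`. [folklore] -/
theorem mem_support_perPoly_mul_monomial {d m : (Fin n × Fin n) →₀ ℕ} {a : ℝ≥0} (ha : a ≠ 0) :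
    m ∈ (perPoly (Fin n) ℝ≥0 * monomial d a).support ↔ ∃ ρ : Equiv.Perm (Fin n), permMonomial ρ + d = m := by
  classical
  rw [mem_support_iff, coeff_mul_monomial']
  constructor
  · intro h
    split_ifs at h with hle
    · have hc : coeff (m - d) (perPoly (Fin n) ℝ≥0) ≠ 0 := fun h0 => h (by rw [h0, zero_mul])
      obtain ⟨ρ, hρ⟩ := exists_permMonomial_eq_of_coeff_perPoly_ne_zero ℝ≥0 hc
      exact ⟨ρ, by rw [hρ, tsub_add_cancel_of_le hle]⟩
    · exact absurd rfl h
  · rintro ⟨ρ, rfl⟩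
    rw [if_pos le_add_self, add_tsub_cancel_right, coeff_permMonomial_perPoly, one_mul]
    exact ha

/-- **Monomial multipliers containing a perfect matching trivialise the Boolean shadow.**  If the
support of the monomial `x^d` contains the pattern of some permutation `ρ₀`, then the shadow of
`per_n · (a x^d)` accepts `S` iff `S ⊇ supp d` — an AND of variables, monotone-trivial.  (The case
`d = 𝟙` is the sibling seat's `shadow_perPoly_mul_prod_X_iff`; `d = μ_{id}` gives "`S` contains the
diagonal".)  So for such multipliers the Boolean transfer is void, at every strength. [folklore] -/
theorem shadow_perPoly_mul_monomial_iff {d : (Fin n × Fin n) →₀ ℕ} {a : ℝ≥0} (ha : a ≠ 0)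
    (ρ₀ : Equiv.Perm (Fin n)) (hρ₀ : ∀ j, (ρ₀ j, j) ∈ d.support) (S : Finset (Fin n × Fin n)) :
    (∃ m ∈ (perPoly (Fin n) ℝ≥0 * monomial d a).support, m.support ⊆ S) ↔ d.support ⊆ S := by
  classical
  constructor
  · rintro ⟨m, hm, hmS⟩
    obtain ⟨ρ, rfl⟩ := (mem_support_perPoly_mul_monomial ha).1 hm
    exact (support_subset_support_add d (permMonomial ρ)).trans (by rwa [add_comm] at hmS)
  · intro hdS
    refine ⟨permMonomial ρ₀ + d, (mem_support_perPoly_mul_monomial ha).2 ⟨ρ₀, rfl⟩, ?_⟩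
    intro v hv
    rcases Finset.mem_union.1 (Finsupp.support_add hv) with h1 | h2
    · obtain ⟨i, j⟩ := v
      have hij : ρ₀ j = i := (mem_support_permMonomial ρ₀ (i, j)).1 h1
      subst hij
      exact hdS (hρ₀ j)
    · exact hdS h2

/-- The instance `d = μ_{id}` (the diagonal monomial `∏ x_ii`): the shadow of `per_n · ∏ x_ii` is
"`S` contains the diagonal". [folklore] -/
theorem shadow_perPoly_mul_diagonal_iff (S : Finset (Fin n × Fin n)) :
    (∃ m ∈ (perPoly (Fin n) ℝ≥0 * monomial (permMonomial 1) 1).support, m.support ⊆ S) ↔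
      ∀ i : Fin n, (i, i) ∈ S := by
  rw [shadow_perPoly_mul_monomial_iff one_ne_zero 1 (fun j => (mem_support_permMonomial 1 _).2 rfl) S]
  constructor
  · intro h i
    exact h ((mem_support_permMonomial 1 (i, i)).2 rfl)
  · intro h v hv
    obtain ⟨i, j⟩ := v
    have hij : j = i := by simpa using (mem_support_permMonomial 1 (i, j)).1 hv
    subst hij
    exact h j

end Summit.ValiantsHypothesis.Theorems.PerMultiplesHardNegative

end
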